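import Literature.Analysis.Matrix.CGLanczosTridiagonal
import HarnessLib

/-!
# CG computes implicitly the Cholesky factorization of the Lanczos Jacobi matrix:
# `T_k = L_k L_kᵀ` with `L_kᵀ` upper bidiagonal, `diag(1/√γ_j)`, `superdiag(√(δ_{j+1}/γ_j))`

Topic `Analysis/Matrix` (the CG ⟷ Lanczos thread: `CGLanczosTridiagonal` assembles Saad's
tridiagonal matrix `T_k = cgLanczosMatrix A b x₀ k` of the CG coefficients and proves that the CG run
IS a Lanczos relation with it; `CGGaussEstimate` identifies `‖r₀‖²(T_k⁻¹)₀₀` with the Gauss estimate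
and lists "the Cholesky pivots `δ_k = 1/γ_{k−1}` of `T_k`" as NOT formalised).  PUBLISHED RESULT with
our (entrywise) proof; definitions = the printed bidiagonal factor; no named fact (D-0026).

HONEST FRAMING: exact (Metropolis-corrected) sampling algorithms for lattice gauge theory; figures
of merit are autocorrelation/cost numbers at stated couplings and volumes; no continuum-physics claim.

## Source (read on the held text `paper:arxiv-1810.02127`, p. 4) and what is taken

G. Meurant, P. Tichý, *Approximating the extreme Ritz values and upper bounds for the A-norm of the
error in CG*, Numer. Algorithms 82 (2019) 937–968 [MeurantTichy2018], §2: "Thanks to this close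
relationship between the CG and Lanczos algorithms it can be shown (see, for instance [Me2006]) that
the recurrence coefficients computed in both algorithms are connected via
`β̃_k = √δ_k/γ_{k−1}`, `α̃_k = 1/γ_{k−1} + δ_{k−1}/γ_{k−2}`, `δ₀ = 0`, `γ₋₁ = 1`" (eq. `alphabeta`;
the tree's `cgLanczosMatrix_diag` / `cgLanczosMatrix_subdiag`, Saad (6.103)); "Writing these formulas
in matrix form, we get **`T_k = L_k L_kᵀ`**, `L_kᵀ = ` the upper bidiagonal matrix with diagonal
`1/√γ₀, …, 1/√γ_{k−1}` and superdiagonal `√(δ₁/γ₀), …, √(δ_{k−1}/γ_{k−2})`.  In other words, CG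
computes implicitly the Cholesky factorization of the Jacobi matrix `T_k` generated by the Lanczos
algorithm. Hence, the eigenvalues of `T_k` (the so-called Ritz values) are equal to the squared
singular values of the upper bidiagonal matrix `L_kᵀ`."  Also G. H. Golub, G. Meurant, *Matrices,
Moments and Quadrature with Applications* (2010) [GolubMeurant2010] §12.3: "`c_k = ‖r^{k−1}‖/‖r⁰‖`
and `γ_{k−1} = 1/δ_k`" (the Cholesky pivots of `J_k` are the `1/γ`'s).

Index conventions (as in `CGLanczosTridiagonal`): the tree's `T_k = cgLanczosMatrix A b x₀ k` is
`(k+1) × (k+1)` on `Fin (k+1)`, built from `γ_0, …, γ_k` (`cgCoeff`), `Δ_0 = 0, Δ_1, …, Δ_k`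
(`cgDelta`, MeTi's `δ`) and `ρ_j = ‖r_j‖` (`cgResNorm`); so the printed `L_kᵀ` (for MeTi's `k`
= our `k + 1`) is the matrix `cgCholeskyUpper A b x₀ k` below with diagonal `1/√γ_j` and
superdiagonal `(j, j+1)` entry `ρ_{j+1}/(ρ_j √γ_j) = √(Δ_{j+1}/γ_j)`.

## What is formalised (`A` positive definite, residuals `r_0, …, r_k ≠ 0`, so `γ_j > 0`, `ρ_j > 0`)

* `cgCholeskyUpper` — the printed upper bidiagonal factor `L_kᵀ`; `cgCholeskyUpper_diag`,
  `cgCholeskyUpper_superdiag`, `cgCholeskyUpper_superdiag_eq_sqrt` (`= √(Δ_{j+1}/γ_j)`, the printed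
  entry), `cgCholeskyUpper_apply_of_ne` (all other entries vanish), `cgCholeskyUpper_blockTriangular`
  (upper triangular);
* **`transpose_mul_cgCholeskyUpper`** — `T_k = L_k L_kᵀ`, i.e. `(L_kᵀ)ᵀ (L_kᵀ) = cgLanczosMatrix`;
* `det_cgCholeskyUpper` (`= ∏_j 1/√γ_j`), **`det_cgLanczosMatrix`** (`det T_k = ∏_{j≤k} 1/γ_j` — the
  Cholesky pivots are the `1/γ_j`), `cgLanczosMatrix_posDef` ("the Ritz values are the squared
  singular values of `L_kᵀ`", stated as: `T_k = RᵀR` with `R` invertible is positive definite).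

NOT formalised: finite-precision statements; the identification of the Ritz values with singular
values as an equality of multisets.
-/

noncomputable section

open Matrix Finset

namespace Literature.Analysis.Matrix

namespace ConjugateGradient

variable {n : Type*} [Fintype n]

/-! ### The bidiagonal factor -/

/-- The superdiagonal entry `(L_kᵀ)_{j,j+1} = ρ_{j+1}/(ρ_j √γ_j)` (`= √(Δ_{j+1}/γ_j)`,
`cgCholeskyUpper_superdiag_eq_sqrt`). [cite: MeurantTichy2018, §2 display `T_k = L_k L_kᵀ`] -/
def cgCholeskyOffDiag (A : Matrix n n ℝ) (b x₀ : n → ℝ) (j : ℕ) : ℝ :=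
  cgResNorm A b x₀ (j + 1) * (cgResNorm A b x₀ j * Real.sqrt (cgCoeff A b x₀ j))⁻¹

/-- **MeTi's `L_kᵀ`**: the upper bidiagonal matrix with diagonal `1/√γ_j` and superdiagonal
`ρ_{j+1}/(ρ_j√γ_j) = √(Δ_{j+1}/γ_j)`, on `Fin (k+1)` (the size of the tree's `T_k`).
[cite: MeurantTichy2018, §2 display `T_k = L_k L_kᵀ`] -/
def cgCholeskyUpper (A : Matrix n n ℝ) (b x₀ : n → ℝ) (k : ℕ) :
    Matrix (Fin (k + 1)) (Fin (k + 1)) ℝ :=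
  Matrix.of fun (i j : Fin (k + 1)) =>
    (if (i : ℕ) = j then (Real.sqrt (cgCoeff A b x₀ j))⁻¹ else 0) +
      (if (j : ℕ) = i + 1 then cgCholeskyOffDiag A b x₀ i else 0)

section Entries

variable (A : Matrix n n ℝ) (b x₀ : n → ℝ) (k : ℕ)

/-- Unfolding lemma for the entries of `L_kᵀ`. [cite: MeurantTichy2018, §2 display `T_k = L_k L_kᵀ`] -/
theorem cgCholeskyUpper_apply (i j : Fin (k + 1)) :
    cgCholeskyUpper A b x₀ k i j =
      (if (i : ℕ) = j then (Real.sqrt (cgCoeff A b x₀ j))⁻¹ else 0) +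
        (if (j : ℕ) = i + 1 then cgCholeskyOffDiag A b x₀ i else 0) :=
  rfl

/-- Diagonal entries `1/√γ_j`. [cite: MeurantTichy2018, §2 display `T_k = L_k L_kᵀ`] -/
theorem cgCholeskyUpper_diag (j : Fin (k + 1)) :
    cgCholeskyUpper A b x₀ k j j = (Real.sqrt (cgCoeff A b x₀ j))⁻¹ := by
  rw [cgCholeskyUpper_apply, if_pos rfl, if_neg (by omega), add_zero]

/-- Superdiagonal entries `ρ_{j+1}/(ρ_j√γ_j)`. [cite: MeurantTichy2018, §2 display `T_k = L_k L_kᵀ`] -/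
theorem cgCholeskyUpper_superdiag (j : Fin k) :
    cgCholeskyUpper A b x₀ k j.castSucc j.succ = cgCholeskyOffDiag A b x₀ j := by
  rw [cgCholeskyUpper_apply, if_neg (by simp), if_pos (by simp), zero_add, Fin.val_castSucc]

/-- All other entries vanish (upper bidiagonal). [cite: MeurantTichy2018, §2 display `T_k = L_k L_kᵀ`] -/
theorem cgCholeskyUpper_apply_of_ne (i j : Fin (k + 1)) (h1 : (i : ℕ) ≠ j) (h2 : (j : ℕ) ≠ i + 1) :
    cgCholeskyUpper A b x₀ k i j = 0 := by
  rw [cgCholeskyUpper_apply, if_neg h1, if_neg h2, add_zero]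

/-- `L_kᵀ` is upper triangular. [cite: MeurantTichy2018, §2 ("the upper bidiagonal matrix `L_kᵀ`")] -/
theorem cgCholeskyUpper_blockTriangular : (cgCholeskyUpper A b x₀ k).BlockTriangular id := by
  intro i j hij
  exact cgCholeskyUpper_apply_of_ne A b x₀ k i j (by simp only [id] at hij; omega)
    (by simp only [id] at hij; omega)

end Entries

/-! ### The printed square-root form of the superdiagonal -/

section Run

variable {A : Matrix n n ℝ} (b x₀ : n → ℝ)

/-- `Δ_{j+1} = ρ_{j+1}²/ρ_j²`. [cite: Saad2003, §6.7.3 (6.102)] -/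
theorem cgDelta_succ_eq (A : Matrix n n ℝ) (j : ℕ) :
    cgDelta A b x₀ (j + 1) = cgResNorm A b x₀ (j + 1) ^ 2 / cgResNorm A b x₀ j ^ 2 := by
  rw [cgDelta, cgResNorm_sq, cgResNorm_sq]

/-- The printed entry: `ρ_{j+1}/(ρ_j√γ_j) = √(δ_{j+1}/γ_j)` (for `ρ_j > 0`, `γ_j > 0`).
[cite: MeurantTichy2018, §2 display `T_k = L_k L_kᵀ` (superdiagonal `√(δ_j/γ_{j−1})`)] -/
theorem cgCholeskyOffDiag_eq_sqrt (hA : A.PosDef) {j : ℕ} (hr : (cgState A b x₀ j).r ≠ 0) :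
    cgCholeskyOffDiag A b x₀ j = Real.sqrt (cgDelta A b x₀ (j + 1) / cgCoeff A b x₀ j) := by
  have hρ := cgResNorm_pos b x₀ A hr
  have hγ := cgCoeff_pos' b x₀ hA hr
  rw [cgCholeskyOffDiag, cgDelta_succ_eq, Real.sqrt_div (div_nonneg (sq_nonneg _) (sq_nonneg _)),
    Real.sqrt_div (sq_nonneg _), Real.sqrt_sq (cgResNorm_nonneg b x₀ A _),
    Real.sqrt_sq hρ.le, mul_inv, div_div, div_eq_mul_inv, mul_inv]

end Run

/-! ### `T_k = L_k L_kᵀ` -/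

section Factor

variable {A : Matrix n n ℝ} {b x₀ : n → ℝ} {k : ℕ}

/-- The strictly upper bidiagonal part `S` of `L_kᵀ` (so that `L_kᵀ = diag(1/√γ) + S`). [folklore] -/
private def superPart (A : Matrix n n ℝ) (b x₀ : n → ℝ) (k : ℕ) :
    Matrix (Fin (k + 1)) (Fin (k + 1)) ℝ :=
  Matrix.of fun (i j : Fin (k + 1)) => if (j : ℕ) = i + 1 then cgCholeskyOffDiag A b x₀ i else 0

/-- Entries of `S`. [folklore] -/
private theorem superPart_apply (i j : Fin (k + 1)) :
    superPart A b x₀ k i j = if (j : ℕ) = i + 1 then cgCholeskyOffDiag A b x₀ i else 0 := rfl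

/-- `L_kᵀ = diag(1/√γ_j) + S`. [folklore] -/
private theorem cgCholeskyUpper_eq_add :
    cgCholeskyUpper A b x₀ k =
      Matrix.diagonal (fun j : Fin (k + 1) => (Real.sqrt (cgCoeff A b x₀ j))⁻¹) +
        superPart A b x₀ k := by
  ext i j
  rw [Matrix.add_apply, cgCholeskyUpper_apply, diagonal_apply, superPart_apply]
  by_cases h : i = j
  · subst h; rw [if_pos rfl, if_pos rfl]
  · rw [if_neg (Fin.val_ne_of_ne h), if_neg h]

/-- `(SᵀS)_{ij} = [i = j ≥ 1] · c_{i−1}²`. [folklore] -/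
private theorem superPart_transpose_mul_superPart_apply (i j : Fin (k + 1)) :
    ((superPart A b x₀ k)ᵀ * superPart A b x₀ k) i j =
      if (i : ℕ) = j ∧ 0 < (i : ℕ) then cgCholeskyOffDiag A b x₀ ((i : ℕ) - 1) ^ 2 else 0 := by
  rw [Matrix.mul_apply]
  simp only [transpose_apply, superPart_apply]
  rcases Nat.eq_zero_or_pos (i : ℕ) with hi | hi
  · rw [if_neg (by omega)]
    exact Finset.sum_eq_zero fun l _ => by rw [if_neg (by omega), zero_mul]
  · have hlt : (i : ℕ) - 1 < k + 1 := by omega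
    rw [Finset.sum_eq_single ⟨(i : ℕ) - 1, hlt⟩]
    · rw [if_pos (by simp; omega)]
      by_cases hij : (i : ℕ) = j
      · rw [if_pos (by simp; omega), if_pos ⟨hij, hi⟩, sq]
      · rw [if_neg (by simp; omega), if_neg (fun h => hij h.1), mul_zero]
    · intro l _ hl
      have : (i : ℕ) ≠ l + 1 := fun h => hl (Fin.ext (by simp; omega))
      rw [if_neg this, zero_mul]
    · intro h; exact absurd (Finset.mem_univ _) h

/-- `(D S)_{ij} = [j = i+1] · off_i` where `off_i = ρ_{i+1}/(ρ_i γ_i)` is `T`'s codiagonal entry. [folklore] -/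
private theorem diagonal_mul_superPart_apply (hA : A.PosDef) (hne : ∀ j ≤ k, (cgState A b x₀ j).r ≠ 0)
    (i j : Fin (k + 1)) :
    (Matrix.diagonal (fun j : Fin (k + 1) => (Real.sqrt (cgCoeff A b x₀ j))⁻¹) * superPart A b x₀ k) i j =
      if (j : ℕ) = i + 1 then cgLanczosOffDiag A b x₀ i else 0 := by
  rw [diagonal_mul, superPart_apply]
  by_cases h : (j : ℕ) = i + 1
  · rw [if_pos h, if_pos h, cgCholeskyOffDiag, cgLanczosOffDiag]
    have hγ := cgCoeff_pos' b x₀ hA (hne i (Nat.lt_succ_iff.mp i.2))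
    rw [mul_inv, mul_inv, show (Real.sqrt (cgCoeff A b x₀ i))⁻¹ * (cgResNorm A b x₀ (i + 1) *
        ((cgResNorm A b x₀ i)⁻¹ * (Real.sqrt (cgCoeff A b x₀ i))⁻¹)) = cgResNorm A b x₀ (i + 1) *
        ((cgResNorm A b x₀ i)⁻¹ * ((Real.sqrt (cgCoeff A b x₀ i))⁻¹ * (Real.sqrt (cgCoeff A b x₀ i))⁻¹))
        by ring, ← mul_inv (Real.sqrt _), Real.mul_self_sqrt hγ.le]
  · rw [if_neg h, if_neg h, mul_zero]

/-- `(Sᵀ D)_{ij} = [i = j+1] · off_j`. [folklore] -/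
private theorem superPart_transpose_mul_diagonal_apply (hA : A.PosDef)
    (hne : ∀ j ≤ k, (cgState A b x₀ j).r ≠ 0) (i j : Fin (k + 1)) :
    ((superPart A b x₀ k)ᵀ * Matrix.diagonal (fun j : Fin (k + 1) => (Real.sqrt (cgCoeff A b x₀ j))⁻¹)) i j =
      if (i : ℕ) = j + 1 then cgLanczosOffDiag A b x₀ j else 0 := by
  have h := diagonal_mul_superPart_apply hA hne j i
  rw [← transpose_apply (Matrix.diagonal _ * superPart A b x₀ k) i j, transpose_mul,
    diagonal_transpose] at h
  exact h

/-- `(D D + SᵀS)_{ii} = 1/γ_i + Δ_i/γ_{i−1}` = `T`'s diagonal entry, and `0` off the diagonal. [folklore] -/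
private theorem dd_add_ss_apply (hA : A.PosDef) (hne : ∀ j ≤ k, (cgState A b x₀ j).r ≠ 0)
    (i j : Fin (k + 1)) :
    (Matrix.diagonal (fun j : Fin (k + 1) => (Real.sqrt (cgCoeff A b x₀ j))⁻¹) *
          Matrix.diagonal (fun j : Fin (k + 1) => (Real.sqrt (cgCoeff A b x₀ j))⁻¹)) i j +
        ((superPart A b x₀ k)ᵀ * superPart A b x₀ k) i j =
      if (i : ℕ) = j then cgLanczosDiag A b x₀ j else 0 := by
  rw [diagonal_mul_diagonal, diagonal_apply, superPart_transpose_mul_superPart_apply]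
  by_cases hij : (i : ℕ) = j
  · have hij' : i = j := Fin.ext hij
    subst hij'
    have hγ := cgCoeff_pos' b x₀ hA (hne i (Nat.lt_succ_iff.mp i.2))
    rw [if_pos rfl, if_pos rfl, ← mul_inv, Real.mul_self_sqrt hγ.le, cgLanczosDiag]
    rcases Nat.eq_zero_or_pos (i : ℕ) with hi | hi
    · rw [if_neg (by omega), add_zero]
      have : cgDelta A b x₀ i = 0 := by rw [hi]; rfl
      rw [this, zero_mul, add_zero]
    · rw [if_pos ⟨rfl, hi⟩]
      congr 1
      obtain ⟨m, hm⟩ : ∃ m, (i : ℕ) = m + 1 := ⟨(i : ℕ) - 1, by omega⟩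
      have hmk : m ≤ k := by have := i.2; omega
      have hγm := cgCoeff_pos' b x₀ hA (hne m hmk)
      have hρm := cgResNorm_pos b x₀ A (hne m hmk)
      rw [hm, Nat.add_sub_cancel, cgCholeskyOffDiag, cgDelta_succ_eq, mul_pow, inv_pow, mul_pow,
        Real.sq_sqrt hγm.le]
      field_simp
  · rw [if_neg (fun h : i = j => hij (congrArg Fin.val h)), if_neg (fun h => hij h.1),
      if_neg hij, add_zero]

/-- **`T_k = L_k L_kᵀ` — CG computes implicitly the Cholesky factorization of the Jacobi matrix**:
for `A` positive definite and `r_0, …, r_k ≠ 0`,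
`(cgCholeskyUpper A b x₀ k)ᵀ * cgCholeskyUpper A b x₀ k = cgLanczosMatrix A b x₀ k`.
[cite: MeurantTichy2018, §2 display `T_k = L_k L_kᵀ` ("CG computes implicitly the Cholesky
factorization of the Jacobi matrix `T_k`")] [cite: GolubMeurant2010, §12.3 (`γ_{k−1} = 1/δ_k`)] -/
theorem transpose_mul_cgCholeskyUpper (hA : A.PosDef) (hne : ∀ j ≤ k, (cgState A b x₀ j).r ≠ 0) :
    (cgCholeskyUpper A b x₀ k)ᵀ * cgCholeskyUpper A b x₀ k = cgLanczosMatrix A b x₀ k := by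
  ext i j
  rw [cgCholeskyUpper_eq_add, transpose_add, diagonal_transpose, Matrix.add_mul, Matrix.mul_add,
    Matrix.mul_add, Matrix.add_apply, Matrix.add_apply, Matrix.add_apply,
    diagonal_mul_superPart_apply hA hne, superPart_transpose_mul_diagonal_apply hA hne,
    cgLanczosMatrix_apply]
  have h := dd_add_ss_apply hA hne i j
  linear_combination h

/-! ### Consequences: the pivots and positive definiteness -/

/-- `det L_kᵀ = ∏_j 1/√γ_j`. [cite: MeurantTichy2018, §2 display `T_k = L_k L_kᵀ`] -/
theorem det_cgCholeskyUpper (A : Matrix n n ℝ) (b x₀ : n → ℝ) (k : ℕ) :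
    (cgCholeskyUpper A b x₀ k).det = ∏ j : Fin (k + 1), (Real.sqrt (cgCoeff A b x₀ j))⁻¹ := by
  rw [det_of_upperTriangular (cgCholeskyUpper_blockTriangular A b x₀ k)]
  exact Finset.prod_congr rfl fun j _ => cgCholeskyUpper_diag A b x₀ k j

/-- **The Cholesky pivots of `T_k` are the `1/γ_j`**: `det T_k = ∏_{j ≤ k} 1/γ_j`.
[cite: GolubMeurant2010, §12.3 ("`γ_{k−1} = 1/δ_k`", `δ_k` the Cholesky pivots of `J_k`)]
[cite: MeurantTichy2018, §2 display `T_k = L_k L_kᵀ`] -/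
theorem det_cgLanczosMatrix (hA : A.PosDef) (hne : ∀ j ≤ k, (cgState A b x₀ j).r ≠ 0) :
    (cgLanczosMatrix A b x₀ k).det = ∏ j : Fin (k + 1), (cgCoeff A b x₀ j)⁻¹ := by
  rw [← transpose_mul_cgCholeskyUpper hA hne, det_mul, det_transpose, det_cgCholeskyUpper,
    ← Finset.prod_mul_distrib]
  refine Finset.prod_congr rfl fun j _ => ?_
  rw [← mul_inv, Real.mul_self_sqrt (cgCoeff_pos' b x₀ hA (hne j (Nat.lt_succ_iff.mp j.2))).le]

/-- `L_kᵀ` is nonsingular. [cite: MeurantTichy2018, §2 (its diagonal `1/√γ_j` is positive)] -/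
theorem isUnit_det_cgCholeskyUpper (hA : A.PosDef) (hne : ∀ j ≤ k, (cgState A b x₀ j).r ≠ 0) :
    IsUnit (cgCholeskyUpper A b x₀ k).det := by
  rw [det_cgCholeskyUpper, isUnit_iff_ne_zero]
  exact Finset.prod_ne_zero_iff.mpr fun j _ => inv_ne_zero (Real.sqrt_pos.mpr
    (cgCoeff_pos' b x₀ hA (hne j (Nat.lt_succ_iff.mp j.2)))).ne'

/-- "The eigenvalues of `T_k` (the so-called Ritz values) are equal to the squared singular values of
the upper bidiagonal matrix `L_kᵀ`" — in particular `T_k = (L_kᵀ)ᵀ L_kᵀ` with `L_kᵀ` nonsingular is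
positive definite. [cite: MeurantTichy2018, §2 (sentence after the display `T_k = L_k L_kᵀ`)] -/
theorem cgLanczosMatrix_posDef (hA : A.PosDef) (hne : ∀ j ≤ k, (cgState A b x₀ j).r ≠ 0) :
    (cgLanczosMatrix A b x₀ k).PosDef := by
  rw [← transpose_mul_cgCholeskyUpper hA hne, ← conjTranspose_eq_transpose_of_trivial]
  exact Matrix.PosDef.conjTranspose_mul_self _
    (Matrix.mulVec_injective_of_isUnit
      ((Matrix.isUnit_iff_isUnit_det _).mpr (isUnit_det_cgCholeskyUpper hA hne)))

end Factor

end ConjugateGradient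

end Literature.Analysis.Matrix
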